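import Literature.NumberTheory.NumberFields.GassmannKleinFour
import HarnessLib

/-!
# Gassmann equivalent subgroups of index at most `6` are conjugate (Perlis 1977, Theorem 3)

Topic `NumberTheory/NumberFields`; theorem-only file (D-0026), last of four files on the group
theory of Perlis's Theorem 3 (overview in `GassmannPermChar`).

* `Gassmann.exists_le_stabilizer` — **the two-actions theorem**: if a finite group acts
  transitively and faithfully on `X` and on `X'`, `#X = #X' ≤ 6`, with the same permutation
  character, then `Stab(x₀')` fixes a point of `X`.  Proof: otherwise both `Stab(x₀')` on `X` and
  (symmetrically) `Stab(x₀)` on `X'` are in the Klein-four configuration of `GassmannKleinFour`;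
  the normal subgroup `M = {g : g • Fix(G_a) = Fix(G_a) for all a ∈ X}` then contains `Stab(x₀')`
  but not `Stab(x₀)`, contradicting `#(Stab(x₀) ∩ M) = #(Stab(x₀') ∩ M)` (`card_inf_eq`).
* `IsGassmannEquivalent.exists_eq_map_conj` — **Gassmann equivalent subgroups `H, H'` with
  `[G : H] ≤ 6` are conjugate**, by applying the above to `G/H`, `G/H'` modulo the common kernel
  (`MulAction.toPermHom`, `QuotientGroup.lift`, `MulAction.compHom`).  Perlis [Perlis1977, Thm. 3,
  pp. 355–358] obtains this by running through the transitive groups of degree `≤ 6` (Huppert's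
  tables); the smallest non-conjugate Gassmann pair has index `7` (loc. cit., end of §4), so the
  bound `6` is sharp.

## References

* [Perlis1977] R. Perlis, *On the equation `ζ_K(s) = ζ_{K'}(s)`*, J. Number Theory 9 (1977),
  342–360: §1 Lemma 1 (Gassmann equivalence via coset types), §4 Theorems 2–3 (pp. 353–358).
* F. Gassmann, *Bemerkungen zu der vorstehenden Arbeit von Hurwitz*, Math. Z. 25 (1926), 124–143
  (cited through Perlis).
-/

noncomputable section

open MulAction Subgroup
open scoped Pointwise

namespace Literature.NumberTheory.NumberFields

namespace Gassmann

section TwoActions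

variable {G : Type*} [Group G] {X X' : Type*} [MulAction G X] [MulAction G X']

variable [Finite G] [Finite X] [Finite X']

/-- **The two-actions theorem.** Let the finite group `G` act transitively and faithfully on `X`
and on `X'`, `#X = #X' ≤ 6`, with the same permutation character. Then the stabilizer of any
point of `X'` fixes a point of `X` (so the two actions are isomorphic). This is the group theory
behind Perlis's Theorem 3, proved here without the classification of transitive groups of
degree `≤ 6` used in [Perlis1977, §4]. [cite: Perlis1977, Thm. 3 (group-theoretic content)] -/
theorem exists_le_stabilizer [IsPretransitive G X] [IsPretransitive G X'] (hc : Nat.card X = Nat.card X')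
    (hf : ∀ g : G, (∀ x : X, g • x = x) → g = 1)
    (hf' : ∀ g : G, (∀ x' : X', g • x' = x') → g = 1)
    (hfix : ∀ g : G, Nat.card (fixedBy X g) = Nat.card (fixedBy X' g))
    (hn : Nat.card X ≤ 6) (x₀' : X') : ∃ x : X, stabilizer G x₀' ≤ stabilizer G x := by
  classical
  by_contra hcon
  push Not at hcon
  have hno : ∀ x : X, ∃ g ∈ stabilizer G x₀', g • x ≠ x := by
    intro x
    by_contra hall
    push Not at hall
    exact hcon x fun g hg => mem_stabilizer_iff.mpr (hall g hg)
  obtain ⟨hA'6, hA'4, hA'comm, hA'orb, -, -, -⟩ := sixStructure hc hf hf' hfix hn le_rfl hno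
  haveI : Nonempty X := Finite.card_pos_iff.mp (by rw [hA'6]; norm_num)
  obtain ⟨x₀⟩ := (inferInstance : Nonempty X)
  -- the symmetric statement: `Stab(x₀)` fixes no point of `X'`
  have hno' : ∀ x' : X', ∃ g ∈ stabilizer G x₀, g • x' ≠ x' := by
    intro x'
    by_contra hall
    push Not at hall
    have hle : stabilizer G x₀ ≤ stabilizer G x' := fun g hg => mem_stabilizer_iff.mpr (hall g hg)
    have hcardeq : Nat.card (stabilizer G x₀) = Nat.card (stabilizer G x') := by
      have e1 := Subgroup.card_mul_index (stabilizer G x₀)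
      have e2 := Subgroup.card_mul_index (stabilizer G x')
      rw [index_stabilizer_of_transitive] at e1 e2
      rw [← hc] at e2
      exact Nat.eq_of_mul_eq_mul_right (Finite.card_pos_iff.mpr ⟨x₀⟩) (e1.trans e2.symm)
    have heq : stabilizer G x₀ = stabilizer G x' :=
      Subgroup.eq_of_le_of_card_ge hle hcardeq.ge
    obtain ⟨k, rfl⟩ := exists_smul_eq G x₀' x'
    apply hcon (k⁻¹ • x₀)
    intro g hg
    rw [mem_stabilizer_iff]
    have h1 : k * g * k⁻¹ ∈ stabilizer G x₀ := by
      rw [heq, mem_stabilizer_iff]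
      simp only [mul_smul, inv_smul_smul, mem_stabilizer_iff.mp hg]
    have h2 := mem_stabilizer_iff.mp h1
    calc g • k⁻¹ • x₀ = k⁻¹ • ((k * g * k⁻¹) • x₀) := by simp only [mul_smul, inv_smul_smul]
      _ = k⁻¹ • x₀ := by rw [h2]
  obtain ⟨-, hA4, -, -, hAfp, hAfix, hAtr⟩ :=
    sixStructure hc.symm hf' hf (fun g => (hfix g).symm) (by rw [← hc]; exact hn) le_rfl hno'
  -- fixed-point sets of the point stabilizers of `X`
  have hF : ∀ a : X, (fixedPoints (stabilizer G a) X).ncard = 2 ∧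
      ∀ u ∈ stabilizer G a, u ≠ 1 → fixedBy X u = fixedPoints (stabilizer G a) X := by
    intro a
    obtain ⟨g, rfl⟩ := exists_smul_eq G x₀ a
    rw [fixedPoints_stabilizer_smul]
    refine ⟨?_, ?_⟩
    · rw [← Set.image_smul, Set.ncard_image_of_injective _ (MulAction.injective g)]
      exact hAfp
    · intro u hu hu1
      rw [stabilizer_smul_eq_stabilizer_map_conj] at hu
      obtain ⟨v, hv, rfl⟩ := Subgroup.mem_map.mp hu
      have hv1 : v ≠ 1 := by
        rintro rfl
        simp at hu1
      have hfv := hAfix v hv hv1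
      show fixedBy X (g * v * g⁻¹) = _
      rw [fixedBy_conj, hfv]
  -- the normal subgroup `M` of elements preserving every `Fix(G_a)`
  let M : Subgroup G := ⨅ a : X, stabilizer G (fixedPoints (stabilizer G a) X)
  have hM : ∀ m : G, m ∈ M ↔
      ∀ a : X, m • fixedPoints (stabilizer G a) X = fixedPoints (stabilizer G a) X := by
    intro m
    simp only [M, Subgroup.mem_iInf, mem_stabilizer_iff]
  haveI hMn : M.Normal := ⟨fun m hm g => (hM _).mpr fun a => by
    rw [mul_smul, mul_smul, ← fixedPoints_stabilizer_smul g⁻¹ a, (hM m).mp hm,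
      fixedPoints_stabilizer_smul, smul_inv_smul]⟩
  -- `Stab(x₀') ≤ M`
  have horbF : ∀ b : X, orbit (stabilizer G x₀') b = fixedPoints (stabilizer G b) X := by
    intro b
    have hidx := Subgroup.card_mul_index (stabilizer (stabilizer G x₀') b)
    rw [index_stabilizer, hA'orb b, hA'4] at hidx
    have hc2 : Nat.card (stabilizer (stabilizer G x₀') b) = 2 := by omega
    have hne : stabilizer (stabilizer G x₀') b ≠ ⊥ := by
      intro hbot; rw [hbot, Subgroup.card_bot] at hc2; omega
    obtain ⟨hh, hh1⟩ := (Subgroup.ne_bot_iff_exists_ne_one).mp hne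
    have hhb : ((hh : stabilizer G x₀') : G) • b = b := mem_stabilizer_iff.mp hh.2
    have hhH' : ((hh : stabilizer G x₀') : G) ∈ stabilizer G x₀' := (hh : stabilizer G x₀').2
    have hh1' : ((hh : stabilizer G x₀') : G) ≠ 1 := fun e => hh1 (Subtype.ext (Subtype.ext e))
    have hfix := (hF b).2 _ (mem_stabilizer_iff.mpr hhb) hh1'
    refine Set.eq_of_subset_of_ncard_le ?_ ?_ (Set.toFinite _)
    · rintro _ ⟨s, rfl⟩
      rw [← hfix, mem_fixedBy]
      show ((hh : stabilizer G x₀') : G) • ((s : G) • b) = (s : G) • b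
      rw [smul_smul, hA'comm _ hhH' s s.2, mul_smul, hhb]
    · rw [(hF b).1, hA'orb b]
  have hH'M : stabilizer G x₀' ≤ M := by
    intro u hu
    rw [hM]
    intro a
    rw [← horbF]
    exact smul_orbit (⟨u, hu⟩ : stabilizer G x₀') a
  -- `Stab(x₀) ≰ M`
  have hcardst : ∀ a b : X, Nat.card (stabilizer G a) = Nat.card (stabilizer G b) :=
    card_stabilizer_eq
  have hHM : ¬ stabilizer G x₀ ≤ M := by
    intro hle
    have hlt : (fixedPoints (stabilizer G x₀) X).ncard < (Set.univ : Set X).ncard := by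
      rw [Set.ncard_univ, (hF x₀).1, hA'6]; norm_num
    obtain ⟨z, -, hz⟩ := Set.exists_mem_notMem_of_ncard_lt_ncard hlt
    have hsub : fixedPoints (stabilizer G z) X ⊆ (fixedPoints (stabilizer G x₀) X)ᶜ := by
      intro y hy hy0
      have hle1 : stabilizer G x₀ ≤ stabilizer G y := fun g hg =>
        mem_stabilizer_iff.mpr (hy0 ⟨g, hg⟩)
      have hle2 : stabilizer G z ≤ stabilizer G y := fun g hg =>
        mem_stabilizer_iff.mpr (hy ⟨g, hg⟩)
      have e1 : stabilizer G x₀ = stabilizer G y :=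
        Subgroup.eq_of_le_of_card_ge hle1 (hcardst y x₀).le
      have e2 : stabilizer G z = stabilizer G y :=
        Subgroup.eq_of_le_of_card_ge hle2 (hcardst y z).le
      apply hz
      intro m
      have hm : (m : G) ∈ stabilizer G z := by rw [e2, ← e1]; exact m.2
      exact mem_stabilizer_iff.mp hm
    have hlt2 : (fixedPoints (stabilizer G z) X).ncard <
        ((fixedPoints (stabilizer G x₀) X)ᶜ).ncard := by
      have hcc := Set.ncard_add_ncard_compl (fixedPoints (stabilizer G x₀) X)
      rw [(hF x₀).1, hA'6] at hcc
      rw [(hF z).1]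
      omega
    obtain ⟨w, hw, hwz⟩ := Set.exists_mem_notMem_of_ncard_lt_ncard hlt2
    obtain ⟨g, hg, hgz⟩ := hAtr z hz w hw
    have hgM := (hM g).mp (hle hg) z
    rw [← fixedPoints_stabilizer_smul, hgz] at hgM
    apply hwz
    rw [← hgM]
    exact fun m => mem_stabilizer_iff.mp m.2
  -- count in the normal subgroup `M`
  have hcount := card_inf_eq hc hfix M x₀ x₀'
  rw [inf_eq_left.mpr hH'M, hA'4] at hcount
  apply hHM
  have heq : stabilizer G x₀ ⊓ M = stabilizer G x₀ :=
    Subgroup.eq_of_le_of_card_ge inf_le_left (by rw [hcount, hA4])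
  exact inf_eq_left.mp heq

end TwoActions

/-! ### Gassmann equivalent subgroups of index at most `6` are conjugate -/

section Subgroups

variable {G : Type*} [Group G]

/-- An element acts trivially on a finite set iff it fixes `#Y` points. [folklore] -/
theorem forall_smul_eq_iff_card_fixedBy {Y : Type*} [MulAction G Y] [Finite Y] (g : G) :
    (∀ y : Y, g • y = y) ↔ Nat.card (fixedBy Y g) = Nat.card Y := by
  rw [Nat.card_coe_set_eq, ← Set.ncard_univ]
  constructor
  · intro hg
    congr 1
    ext y
    simpa using hg y
  · intro hg y
    have huniv : fixedBy Y g = Set.univ :=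
      Set.eq_of_subset_of_ncard_le (Set.subset_univ _) hg.ge
    have hy : y ∈ fixedBy Y g := huniv ▸ Set.mem_univ y
    exact hy

variable [Finite G]

/-- **Perlis 1977, Theorem 3 (group-theoretic form).** Gassmann equivalent subgroups of index
at most `6` of a finite group are conjugate: if `H, H' ≤ G` meet every conjugacy class in the same
number of elements and `[G : H] ≤ 6`, then `H' = g H g⁻¹` for some `g ∈ G`. (Perlis proves this
by running through the transitive groups of degree `≤ 6` [Perlis1977, §4, proof of Thm. 3];
here it follows from `exists_le_stabilizer` applied to `G/H`, `G/H'` made faithful.)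
[cite: Perlis1977, Thm. 3 and §4 (pp. 355–358)] -/
theorem _root_.Literature.NumberTheory.NumberFields.IsGassmannEquivalent.exists_eq_map_conj
    {H H' : Subgroup G} (hG : IsGassmannEquivalent H H')
    (hidx : H.index ≤ 6) : ∃ g : G, H' = H.map (MulAut.conj g).toMonoidHom := by
  classical
  have hcardHH' : Nat.card H = Nat.card H' := hG.card_eq
  have hidx' : H.index = H'.index := by
    have e1 := H.card_mul_index
    have e2 := H'.card_mul_index
    rw [hcardHH'] at e1
    exact Nat.eq_of_mul_eq_mul_left Nat.card_pos (e1.trans e2.symm)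
  have hfix : ∀ g : G, Nat.card (fixedBy (G ⧸ H) g) = Nat.card (fixedBy (G ⧸ H') g) :=
    hG.card_fixedBy_quotient_eq
  -- the common kernel of the two actions
  let ρ : G →* Equiv.Perm (G ⧸ H) := MulAction.toPermHom G (G ⧸ H)
  let ρ' : G →* Equiv.Perm (G ⧸ H') := MulAction.toPermHom G (G ⧸ H')
  have hker : ∀ g : G, g ∈ ρ.ker ↔ ∀ x : G ⧸ H, g • x = x := by
    intro g
    rw [MonoidHom.mem_ker]
    constructor
    · intro e x
      have := congrArg (fun p : Equiv.Perm (G ⧸ H) => p x) e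
      simpa [ρ] using this
    · intro hx
      ext x
      simpa [ρ] using hx x
  have hker' : ∀ g : G, g ∈ ρ'.ker ↔ ∀ x : G ⧸ H', g • x = x := by
    intro g
    rw [MonoidHom.mem_ker]
    constructor
    · intro e x
      have := congrArg (fun p : Equiv.Perm (G ⧸ H') => p x) e
      simpa [ρ'] using this
    · intro hx
      ext x
      simpa [ρ'] using hx x
  have htriv : ∀ g : G, (∀ x : G ⧸ H, g • x = x) ↔ (∀ x : G ⧸ H', g • x = x) := by
    intro g
    rw [forall_smul_eq_iff_card_fixedBy, forall_smul_eq_iff_card_fixedBy, hfix g]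
    change _ = H.index ↔ _ = H'.index
    rw [hidx']
  have hKK' : ρ.ker ≤ ρ'.ker := fun g hg => (hker' g).mpr ((htriv g).mp ((hker g).mp hg))
  -- the faithful quotient and its two actions
  let ρQ : G ⧸ ρ.ker →* Equiv.Perm (G ⧸ H) := QuotientGroup.lift ρ.ker ρ le_rfl
  let ρQ' : G ⧸ ρ.ker →* Equiv.Perm (G ⧸ H') := QuotientGroup.lift ρ.ker ρ' hKK'
  letI aX : MulAction (G ⧸ ρ.ker) (G ⧸ H) := MulAction.compHom (G ⧸ H) ρQ
  letI aX' : MulAction (G ⧸ ρ.ker) (G ⧸ H') := MulAction.compHom (G ⧸ H') ρQ'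
  have smulQ : ∀ (g : G) (x : G ⧸ H), (QuotientGroup.mk g : G ⧸ ρ.ker) • x = g • x := by
    intro g x
    show (ρQ (QuotientGroup.mk g)) x = g • x
    simp [ρQ, ρ]
  have smulQ' : ∀ (g : G) (x : G ⧸ H'), (QuotientGroup.mk g : G ⧸ ρ.ker) • x = g • x := by
    intro g x
    show (ρQ' (QuotientGroup.mk g)) x = g • x
    simp [ρQ', ρ']
  have hcQ : Nat.card (G ⧸ H) = Nat.card (G ⧸ H') := hidx'
  have hfQ : ∀ q : G ⧸ ρ.ker, (∀ x : G ⧸ H, q • x = x) → q = 1 := fun q hq => by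
    obtain ⟨g, rfl⟩ := QuotientGroup.mk_surjective q
    rw [QuotientGroup.eq_one_iff]
    exact (hker g).mpr fun x => by rw [← smulQ]; exact hq x
  have hfQ' : ∀ q : G ⧸ ρ.ker, (∀ x : G ⧸ H', q • x = x) → q = 1 := fun q hq => by
    obtain ⟨g, rfl⟩ := QuotientGroup.mk_surjective q
    rw [QuotientGroup.eq_one_iff]
    exact (hker g).mpr ((htriv g).mpr fun x => by rw [← smulQ']; exact hq x)
  have hfixQ : ∀ q : G ⧸ ρ.ker,
      Nat.card (fixedBy (G ⧸ H) q) = Nat.card (fixedBy (G ⧸ H') q) := fun q => by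
    obtain ⟨g, rfl⟩ := QuotientGroup.mk_surjective q
    have e1 : fixedBy (G ⧸ H) (QuotientGroup.mk g : G ⧸ ρ.ker) = fixedBy (G ⧸ H) g := by
      ext x; simp only [mem_fixedBy, smulQ]
    have e2 : fixedBy (G ⧸ H') (QuotientGroup.mk g : G ⧸ ρ.ker) = fixedBy (G ⧸ H') g := by
      ext x; simp only [mem_fixedBy, smulQ']
    rw [e1, e2]
    exact hfix g
  haveI : IsPretransitive (G ⧸ ρ.ker) (G ⧸ H) := ⟨fun x y => by
    obtain ⟨g, hg⟩ := exists_smul_eq G x y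
    exact ⟨QuotientGroup.mk g, by rw [smulQ]; exact hg⟩⟩
  haveI : IsPretransitive (G ⧸ ρ.ker) (G ⧸ H') := ⟨fun x y => by
    obtain ⟨g, hg⟩ := exists_smul_eq G x y
    exact ⟨QuotientGroup.mk g, by rw [smulQ']; exact hg⟩⟩
  obtain ⟨x, hx⟩ := exists_le_stabilizer hcQ hfQ hfQ' hfixQ (show H.index ≤ 6 from hidx)
    ((1 : G) : G ⧸ H')
  obtain ⟨g₁, rfl⟩ := QuotientGroup.mk_surjective x
  refine ⟨g₁, ?_⟩
  have hle : H' ≤ H.map (MulAut.conj g₁).toMonoidHom := by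
    intro h' hh'
    have h1 : (QuotientGroup.mk h' : G ⧸ ρ.ker) ∈ stabilizer (G ⧸ ρ.ker) ((1 : G) : G ⧸ H') := by
      rw [mem_stabilizer_iff, smulQ']
      exact mem_stabilizer_iff.mp (by rw [stabilizer_quotient]; exact hh')
    have h2 := hx h1
    rw [mem_stabilizer_iff, smulQ] at h2
    have h3 : h' ∈ stabilizer G ((g₁ : G) : G ⧸ H) := mem_stabilizer_iff.mpr h2
    have e : ((g₁ : G) : G ⧸ H) = g₁ • ((1 : G) : G ⧸ H) := by
      rw [MulAction.Quotient.smul_coe, smul_eq_mul, mul_one]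
    rw [e, stabilizer_smul_eq_stabilizer_map_conj, stabilizer_quotient] at h3
    exact h3
  refine Subgroup.eq_of_le_of_card_ge hle ?_
  have hcm : Nat.card (H.map (MulAut.conj g₁).toMonoidHom) = Nat.card H :=
    (Nat.card_congr (H.equivMapOfInjective _ (MulAut.conj g₁).injective).toEquiv).symm
  rw [hcm, hcardHH']

end Subgroups

end Gassmann

end Literature.NumberTheory.NumberFields
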